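import Summits.QuantumFields.QCD.Theorems.PauliWegnerSeaChiralGluonicCompletionRetypeGoldstoneSkeleton
import Summits.QuantumFields.QCD.Theorems.PauliWegnerSeaChiralGluonicCompletionGoldstoneOfMobilityGapPlus
import Summits.QuantumFields.QCD.Theorems.PauliWegnerSeaChiralGluonicCompletionGoldstoneOfHereditaryPin
import Summits.QuantumFields.QCD.Theses.GaussianLinkFrames
import Summits.QuantumFields.QCD.Theorems.QuarksNoInfraredClauseThinQCDStubUvWindowLaw
import Summits.QuantumFields.QCD.Theorems.QuarksAsStableActionStableActionBridgeSoftClosureQCD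
import Summits.QuantumFields.QCD.Theorems.QuarksAsStableActionStableActionBridgeDefs

/-!
# Crux `ChiralGluonicCompletion` (stmt-QuantumFields-17498) — line `goldstone-split` (crux-strategist, wall-breaker p1, 2026-08-17)

REGISTERED SKELETON of the strategist's line.  It is DECOMPOSITION-SHAPED on purpose: the crux as typed is an
ASSEMBLY of three crux-sized pieces (eight lead cycles, four triagers, cdisprove: E* ∧ C1 ∧ C2'), and the one piece
that killed every earlier line — the chirality transfer (α) — is re-cut here so that it is no longer E*-class.

* §1 three registered stubs:
  - `stub_goldstonePinUpgrade` — WITNESS-FREE pin upgrade `HypC N_f → HypGold N_f` (shape of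
    `DiagonalSpine.ChiralTuning`, stmt-17436).  NOT a statement about the given witness's subsequences, so the
    pin-shape countermodels (p142184 / p144745 / p146141) and mass-blindness (p150170) say nothing against it;
    it is WEAKER than the dead stub E* given C1 (§3 `goldstonePinUpgrade_of_hereditaryPin`, p137857) and it has a
    NAMED SUPPLIER: `MobilityGapPlus` (the registered line target of crux `ChiralMobilityGap`, stmt-17497) with
    `PhaseQuenchedFlavourDecay` (stmt-9151) — §3 `goldstonePinUpgrade_of_supplier`, sorry-free, via
    `goldstone_of_mobilityGapPlus` (p136657).  Lead verdict expected and honest: `blocked-on` those two, never `line-dead`.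
  - `stub_packageLatticeGap` — C1 with the idle pin dropped: pin-free, ∀-given-regularisation `FullLatticeGap`
    (8928 is ∃-form).  Implies the typed C1 (§3).
  - `stub_packageContinuum` — C2' with the idle pin dropped: pin-free, ∀-given-regularisation, gap-conditioned
    `LatticeToContinuum` along one subsequence for all tuples (8929 is ∃-form; local ⇒ global p139623).  Implies the typed C2' (§3).
* §2 the kernel-checked composition `qcdOf_of_stubs : stub₁ → stub₂ → stub₃ → (crux unfolded)` and the registered
  `WilsonMobilityGap_ChiralGluonicCompletion_of` / `ChiralGluonicCompletion_of` applying it to the stubs BY NAME (three lines over `chiralGluonicCompletionGoldstone_of_goldstoneStubs`, p143054: the Goldstone bound restricts along the continuum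
  subsequence, so NO chirality stub is consumed inside the completion), twins for the rfl-equal WilsonMobilityGap / GaussianLinkFrames
  copies (proof-of-item by name, modulo the three sorries).
* §3 sorry-free calibration: supplier ⇒ stub₁; E* ∧ C1 ⇒ stub₁; stub₂ ⇒ typed C1; stub₃ ⇒ typed C2'; and `Iff.rfl` identities tying
  the three stub signatures to the INLINED texts of the strategist's `children.json` (the same three statements as route items —
  `route edit --split ChiralGluonicCompletion --into children.json`, deferred by the gate to a seat's final cycle; glue = this file's §2,
  attached as evidence `split.lean` for a prover to land under Theorems/).
`lean check`: rc 0, exactly 3 sorries (the stubs).  Card: `Lines/goldstone-split.md`.  Census: `STRATEGY-CENSUS.md`.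

RESHAPE rev 2 (lead c10, 2026-08-17, line cycle 11): stub 3 `stub_packageContinuum` is no longer a `sorry` — it is PROVED in §1b from
two registered stubs in the compactness-ready shape of `ThinQCD`'s S2 (`QuarksNoInfraredClauseThinQCDStubUvWindowLaw`, landed):
  - `stub_packageCompactnessReady` (OPEN — child `PackageContinuum`'s honest content for the GIVEN regularisation: species
    renormalisations `z m, shift m` chosen mass-equicontinuously (`IsMassEquicontinuous`, DiagonalSpine.MassEquicontinuity-shaped),
    k-eventual bounds on a countable family of test data (CalibratedTightness-shaped), and the CLOSURE clause — every subsequence along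
    which the countable family converges carries OS data `T` with full convergence on off-diagonal real tensors, non-triviality ×3 and a
    mass gap; the closure clause is where the scheme-generic OS engine `ConvergentOSClosure.stub_closureOfLatticeInputs` (landed 12:45Z)
    / `exists_osData_qcd_of_package` enter with their lattice-side inputs T ∧ COMP, CL, CS, floors ×3, E1);
  - `stub_packageContinuum_of_compactnessReady` (PROVED; LANDED p163529, imported): the diagonal Arzelà–Ascoli step
    (`exists_strictMono_forall_mass_tendsto`) + `isQCDAlong_restrict_scheme` + clause (i) of `PerMass` for the physical branch.
Registered stubs after rev 2: `stub_goldstonePinUpgrade`, `stub_packageLatticeGap`, `stub_packageCompactnessReady` (3 sorries);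
the composition `WilsonMobilityGap_ChiralGluonicCompletion_of` and the `children.json` identities of §3 are unchanged.
-/

noncomputable section

namespace Summit.QuantumFields.QCD.Cruxes.ChiralGluonicCompletion.GoldstoneSplit

open scoped SchwartzMap
open MeasureTheory Filter Topology
open Literature.MathematicalPhysics.QuantumFieldTheory Literature.MathematicalPhysics.QuantumLattice
  Literature.MathematicalPhysics.AQFT
  Literature.Probability.LatticeModels
open Summit.QuantumFields.QCD.Theses
open Summit.QuantumFields.QCD.Theorems.StronglyChiralSubsequence
open Summit.QuantumFields.QCD.Theorems.ChiralMobilityGapSketch (MobilityGapPlus)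
open Summit.QuantumFields.QCD.Cruxes.StableActionBridge.Sketch (qcdLatticeDist)

/-! ## §1 The three registered stubs -/

/-- **Stub 1 — the WITNESS-FREE Goldstone pin upgrade** (`HypC N_f → HypGold N_f`): if some regularisation carries the typed
package (`Hyp`: mass scaling, the `∃ᶠ`-type pin `IsChiralAtZero`, asymptotic scaling, per-mass package), then SOME regularisation
carries the same package with the EVENTUAL Goldstone bound `HasGoldstoneBound` in place of the pin.  Supplier-side content
(§3 `goldstonePinUpgrade_of_supplier`); not selectable from the given witness. -/
theorem stub_goldstonePinUpgrade : ∀ Nf : ℕ, Nf = 2 ∨ Nf = 3 → (∃ reg : QCDRegularisation Nf, Hyp Nf reg) → ∃ reg : QCDRegularisation Nf, reg.HasMassScaling ∧ reg.HasGoldstoneBound ∧ (reg.scheme 0 0 0).HasAsymptoticScaling ∧ ∀ m : Fin Nf → ℝ, (∀ f, 0 < m f) → PerMass Nf reg m := by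
  sorry

/-- **Stub 2 — `PackageLatticeGap`** (pin-free C1): every AF, mass-scaling regularisation whose every positive tuple carries the
per-mass package has a signed, all-volume uniform lattice gap at every positive tuple.  Contains the weak-coupling lattice YM gap
(heavy tuples) and the sign on tori `S > L_k` (no blow-up). -/
theorem stub_packageLatticeGap : ∀ Nf : ℕ, Nf = 2 ∨ Nf = 3 → ∀ reg : QCDRegularisation Nf, reg.HasMassScaling → (reg.scheme 0 0 0).HasAsymptoticScaling → (∀ m : Fin Nf → ℝ, (∀ f, 0 < m f) → PerMass Nf reg m) → ∀ m : Fin Nf → ℝ, (∀ f, 0 < m f) → ∃ Δ > 0, (reg.scheme m 0 0).HasLatticeMassGap Δ := by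
  sorry

/-! ## §1b Stub 3 reshaped (rev 2): the compactness-ready bundle and the closed diagonal step -/

/-! ### Rev 4 packaging (lead c10): the ledger caps registered stub signatures at 3900 characters (`skeleton check` truncates, `stub-add`
refuses > 4000), so the engine-shaped conjuncts are carried by three REDUCIBLE abbreviations — proposed for the tree as
`Theorems/WilsonMobilityGapChiralGluonicCompletionGoldstoneSplitDefs.lean` (namespace `Summit.QuantumFields.QCD.Theorems.GoldstoneSplit`,
review-queued); until that lands the skeleton keeps byte-identical LOCAL copies (to be deleted in favour of the import). -/

/-- The lattice-side inputs at the tuple `m` for `sch := reg.scheme m z shift` that are stated along the FULL sequence `k`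
(T-bound, RP, CL, CS+GAP, floors ×3) plus the rotation module over all strictly increasing `φ` — conjuncts (ii)–(ix) of
`stub_packageLatticeInputs`, verbatim with `z m, shift m ↦ z, shift`. -/
abbrev LatticeSideInputs (Nf : ℕ) (reg : QCDRegularisation Nf) (m : Fin Nf → ℝ) (z shift : QCDField Nf → ℕ → ℝ) : Prop :=
  (∃ (s : ℕ) (α β : ℝ), 0 ≤ α ∧ ∀ (n' : ℕ) (σ' : Fin n' → QCDField Nf), ∀ᶠ k in atTop, ∀ F : SchwartzMap (Fin n' → EuclideanSpace ℝ (Fin 4)) ℂ, IsOffDiagonal F → ‖qcdLatticeDist (reg.scheme m z shift) k n' σ' F‖ ≤ α * (n'.factorial : ℝ) ^ β * schwartzNorm (n' * s) F) ∧ (∀ (N : ℕ) (deg : Fin N → ℕ) (lab : (j : Fin N) → Fin (deg j) → QCDField Nf) (G : (j : Fin N) → SchwartzMap (Fin (deg j) → EuclideanSpace ℝ (Fin 4)) ℂ), (∀ j, IsTimeOrdered (G j)) → ∀ H : (i j : Fin N) → SchwartzMap (Fin (deg i + deg j) → EuclideanSpace ℝ (Fin 4)) ℂ, (∀ i j, IsAppendTensorOf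 (H i j) (osAdjoint (G i)) (G j)) → ∀ ε : ℝ, 0 < ε → ∀ᶠ l in atTop, -ε ≤ (∑ i, ∑ j, qcdLatticeDist (reg.scheme m z shift) l (deg i + deg j) (Fin.append (lab i ∘ Fin.rev) (lab j)) (H i j)).re ∧ |(∑ i, ∑ j, qcdLatticeDist (reg.scheme m z shift) l (deg i + deg j) (Fin.append (lab i ∘ Fin.rev) (lab j)) (H i j)).im| ≤ ε) ∧ (∀ (n' m' : ℕ) (σ' : Fin n' → QCDField Nf) (σ'' : Fin m' → QCDField Nf) (F : SchwartzMap (Fin n' → EuclideanSpace ℝ (Fin 4)) ℂ) (G : SchwartzMap (Fin m' → EuclideanSpace ℝ (Fin 4)) ℂ), IsTimeOrdered F → IsTimeOrdered G → ∀ a : EuclideanSpace ℝ (Fin 4), a 0 = 0 → a ≠ 0 → ∀ ε : ℝ, 0 < ε → ∃ t₀ : ℝ, ∀ t : ℝ, t₀ ≤ t → ∀ H : SchwartzMap (Fin (n' + m') → EuclideanSpace ℝ (Fin 4)) ℂ, IsAppendTensorOf H (osAdjoint F) (translateMulti (t • a) G) → ∀ᶠ k in atTop, ‖qcdLatticeDist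 (reg.scheme m z shift) k (n' + m') (Fin.append (σ' ∘ Fin.rev) σ'') H - qcdLatticeDist (reg.scheme m z shift) k n' (σ' ∘ Fin.rev) (osAdjoint F) * qcdLatticeDist (reg.scheme m z shift) k m' σ'' G‖ ≤ ε) ∧ (∃ Δ : ℝ, 0 < Δ ∧ (reg.scheme m z shift).HasSpeciesCSClustering Δ ∧ (reg.scheme m z shift).HasLatticeMassGap Δ) ∧ (∃ (F G : SchwartzMap (Fin 1 → EuclideanSpace ℝ (Fin 4)) ℂ) (H : SchwartzMap (Fin (1 + 1) → EuclideanSpace ℝ (Fin 4)) ℂ), IsTimeOrdered F ∧ IsTimeOrdered G ∧ IsAppendTensorOf H (osAdjoint F) G ∧ ∃ ε : ℝ, 0 < ε ∧ ∀ᶠ k in atTop, ε ≤ ‖qcdLatticeDist (reg.scheme m z shift) k (1 + 1) (fun _ => QCDField.glue) H - qcdLatticeDist (reg.scheme m z shift) k 1 (fun _ => QCDField.glue) (osAdjoint F) * qcdLatticeDist (reg.scheme m z shift) k 1 (fun _ => QCDField.glue) G‖) ∧ (∀ fl gl : Fin Nf, fl ≠ gl → ∃ (F G : SchwartzMap (Fin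 1 → EuclideanSpace ℝ (Fin 4)) ℂ) (H : SchwartzMap (Fin (1 + 1) → EuclideanSpace ℝ (Fin 4)) ℂ), IsTimeOrdered F ∧ IsTimeOrdered G ∧ IsAppendTensorOf H (osAdjoint F) G ∧ ∃ ε : ℝ, 0 < ε ∧ ∀ᶠ k in atTop, ε ≤ ‖qcdLatticeDist (reg.scheme m z shift) k (1 + 1) (fun _ => QCDField.pseudoRe fl gl) H - qcdLatticeDist (reg.scheme m z shift) k 1 (fun _ => QCDField.pseudoRe fl gl) (osAdjoint F) * qcdLatticeDist (reg.scheme m z shift) k 1 (fun _ => QCDField.pseudoRe fl gl) G‖) ∧ (∃ (g₁ g₂ g₃ : SchwartzMap (EuclideanSpace ℝ (Fin 4)) ℂ) (Ffgh : SchwartzMap (Fin 3 → EuclideanSpace ℝ (Fin 4)) ℂ) (Fgh Ffh Ffg : SchwartzMap (Fin 2 → EuclideanSpace ℝ (Fin 4)) ℂ) (Ff Fg Fh : SchwartzMap (Fin 1 → EuclideanSpace ℝ (Fin 4)) ℂ), IsTensorOf Ffgh ![g₁, g₂, g₃] ∧ IsOffDiagonal Ffgh ∧ IsTensorOf Fgh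 ![g₂, g₃] ∧ IsTensorOf Ffh ![g₁, g₃] ∧ IsTensorOf Ffg ![g₁, g₂] ∧ IsOffDiagonal Fgh ∧ IsOffDiagonal Ffh ∧ IsOffDiagonal Ffg ∧ IsTensorOf Ff ![g₁] ∧ IsTensorOf Fg ![g₂] ∧ IsTensorOf Fh ![g₃] ∧ ∃ ε : ℝ, 0 < ε ∧ ∀ᶠ k in atTop, ε ≤ ‖qcdLatticeDist (reg.scheme m z shift) k 3 (fun _ => QCDField.glue) Ffgh - qcdLatticeDist (reg.scheme m z shift) k 1 (fun _ => QCDField.glue) Ff * qcdLatticeDist (reg.scheme m z shift) k 2 (fun _ => QCDField.glue) Fgh - qcdLatticeDist (reg.scheme m z shift) k 1 (fun _ => QCDField.glue) Fg * qcdLatticeDist (reg.scheme m z shift) k 2 (fun _ => QCDField.glue) Ffh - qcdLatticeDist (reg.scheme m z shift) k 1 (fun _ => QCDField.glue) Fh * qcdLatticeDist (reg.scheme m z shift) k 2 (fun _ => QCDField.glue) Ffg + 2 * (qcdLatticeDist (reg.scheme m z shift) k 1 (fun _ => QCDField.glue) Ff * qcdLatticeDist (reg.scheme m z shift) k 1 (fun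 _ => QCDField.glue) Fg * qcdLatticeDist (reg.scheme m z shift) k 1 (fun _ => QCDField.glue) Fh)‖) ∧ (∀ φ : ℕ → ℕ, StrictMono φ → ∀ S : LabelledSchwingerFamily (QCDField Nf) (EuclideanSpace ℝ (Fin 4)), (∀ n' : ℕ, n' ≠ 0 → ∀ (σ' : Fin n' → QCDField Nf) (f' : Fin n' → SchwartzMap (EuclideanSpace ℝ (Fin 4)) ℝ) (F : SchwartzMap (Fin n' → EuclideanSpace ℝ (Fin 4)) ℂ), IsTensorOf F (fun i => ofRealTest (f' i)) → IsOffDiagonal F → Tendsto (fun k => qcdLatticeSchwinger (reg.scheme m z shift) (φ k) n' σ' f') atTop (𝓝 (S n' σ' F))) → ∀ (n' : ℕ) (σ' : Fin n' → QCDField Nf) (R : (EuclideanSpace ℝ (Fin 4)) ≃ₗᵢ[ℝ] (EuclideanSpace ℝ (Fin 4))), LinearMap.det (R.toLinearEquiv : (EuclideanSpace ℝ (Fin 4)) →ₗ[ℝ] (EuclideanSpace ℝ (Fin 4))) = 1 → ∀ F : SchwartzMap (Fin n' → EuclideanSpace ℝ (Fin 4)) ℂ, IsOffDiagonal F → S n'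 σ' (linActMulti R F) = S n' σ' F)

/-- (EXT) at the tuple `m` over the countable family `(n, σ, f)`: conjunct (i) of `stub_packageLatticeInputs`, verbatim. -/
abbrev LatticeExtInputs (Nf : ℕ) (reg : QCDRegularisation Nf) {ι : Type} (n : ι → ℕ) (σ : (i : ι) → Fin (n i) → QCDField Nf)
    (f : (i : ι) → Fin (n i) → SchwartzMap (EuclideanSpace ℝ (Fin 4)) ℝ) (m : Fin Nf → ℝ) (z shift : QCDField Nf → ℕ → ℝ) : Prop :=
  (∀ φ : ℕ → ℕ, StrictMono φ → (∀ i, ∃ l : ℂ, Tendsto (fun k => qcdLatticeSchwinger (reg.scheme m z shift) (φ k) (n i) (σ i) (f i)) atTop (𝓝 l)) → ∀ (n' : ℕ) (σ' : Fin n' → QCDField Nf) (F : SchwartzMap (Fin n' → EuclideanSpace ℝ (Fin 4)) ℂ), IsOffDiagonal F → ∃ c : ℂ, Tendsto (fun k => qcdLatticeDist (reg.scheme m z shift) (φ k) n' σ' F) atTop (𝓝 c))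

/-- The closure clause of the compactness-ready bundle at the tuple `m` over the family `(n, σ, f)`, verbatim. -/
abbrev CompactnessClosure (Nf : ℕ) (reg : QCDRegularisation Nf) {ι : Type} (n : ι → ℕ) (σ : (i : ι) → Fin (n i) → QCDField Nf)
    (f : (i : ι) → Fin (n i) → SchwartzMap (EuclideanSpace ℝ (Fin 4)) ℝ) (m : Fin Nf → ℝ) (z shift : QCDField Nf → ℕ → ℝ) : Prop :=
  ∀ φ : ℕ → ℕ, StrictMono φ → (∀ i, ∃ l : ℂ, Tendsto (fun k => qcdLatticeSchwinger (reg.scheme m z shift) (φ k) (n i) (σ i) (f i)) atTop (𝓝 l)) → ∃ T : OSData (QCDField Nf) 4, (∀ n' : ℕ, n' ≠ 0 → ∀ (σ' : Fin n' → QCDField Nf) (f' : Fin n' → SchwartzMap (EuclideanSpace ℝ (Fin 4)) ℝ) (F : SchwartzMap (Fin n' → EuclideanSpace ℝ (Fin 4)) ℂ), IsTensorOf F (fun i => ofRealTest (f' i)) → IsOffDiagonal F → Tendsto (fun k => qcdLatticeSchwinger (reg.scheme m z shift) (φ k) n' σ' f') atTop (𝓝 (T.schwinger n' σ' F))) ∧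 T.IsNontrivial QCDField.glue ∧ T.IsNonGaussian QCDField.glue ∧ (∀ f g : Fin Nf, f ≠ g → T.IsNontrivial (QCDField.pseudoRe f g)) ∧ ∃ Δ > 0, T.HasMassGap Δ

/-- **Stub 3a-i — the LATTICE-SIDE INPUT BUNDLE for child `PackageContinuum` (OPEN; rev 3, packaged rev 4).**  For `N_f ∈ {2,3}` and every AF
mass-scaling regularisation carrying the per-mass package and a lattice gap at every positive tuple: species renormalisations `z m, shift m`
(mass-equicontinuous, `IsMassEquicontinuous`), a countable family of test data with k-eventual bounds at every positive tuple, and AT EVERY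
positive tuple `m`, for the scheme `sch := reg.scheme m (z m) (shift m)` and its canonical lattice distributions `qcdLatticeDist sch k` along the
FULL sequence: (EXT) along every strictly increasing `φ` on which the countable family converges, ALL `qcdLatticeDist sch (φ k) n σ F`,
`F ∈ ⁰𝒮`, converge (density + E0′-equicontinuity: `exists_countable_dense_subset_schwartzMap`, `stub_offDiagonalTensorDensity`);
(T) a k-uniform E0′ bound on `⁰𝒮` (P2 of `exists_osData_qcd_of_package`; `DiagonalSpine.CalibratedTightness`-type);
(RP) eventually approximately positive OS forms (P8; from the periodic/Θ-symmetrised thermal comparison, `stub_rpOfComparison`-type);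
(CL) k-uniform spatial clustering (P9); (CS+GAP) species Cauchy–Schwarz clustering and the lattice gap at ONE rate `Δ > 0` (P10);
(FLOORS) eventual lower bounds on the glue and flavour-changing pseudoscalar truncated two-point functions and on `κ₃(glue)` (P11 ×3);
(E1) rotation restoration: every subsequential limit of the lattice `n`-point functions on off-diagonal real tensors is invariant under proper
rotations (`DiagonalSpine.RotationRestoration` 8840-type).  P4 (normalisation), P6 (translations) and P7 (permutations) of the engine are
NOT inputs: they are theorems of the tree (`qcdLatticeDist_zero_apply`, `tendsto_qcdLatticeDist_translateMulti_sub`, `stub_permExact`). -/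
theorem stub_packageLatticeInputs : ∀ Nf : ℕ, Nf = 2 ∨ Nf = 3 → ∀ reg : QCDRegularisation Nf, reg.HasMassScaling → (reg.scheme 0 0 0).HasAsymptoticScaling → (∀ m : Fin Nf → ℝ, (∀ f, 0 < m f) → PerMass Nf reg m) → (∀ m : Fin Nf → ℝ, (∀ f, 0 < m f) → ∃ Δ > 0, (reg.scheme m 0 0).HasLatticeMassGap Δ) → ∃ (z shift : (Fin Nf → ℝ) → QCDField Nf → ℕ → ℝ) (ι : Type) (_ : Countable ι) (n : ι → ℕ) (σ : (i : ι) → Fin (n i) → QCDField Nf) (f : (i : ι) → Fin (n i) → SchwartzMap (EuclideanSpace ℝ (Fin 4)) ℝ), (∀ i, n i ≠ 0) ∧ IsMassEquicontinuous reg z shift ∧ (∀ i, ∀ m : Fin Nf → ℝ, (∀ fl, 0 < m fl) → ∃ R : ℝ, ∀ᶠ k in atTop, ‖qcdLatticeSchwinger (reg.scheme m (z m) (shift m)) k (n i) (σ i) (f i)‖ ≤ R) ∧ (∀ m : Fin Nf → ℝ, (∀ fl, 0 < m fl) → LatticeExtInputs Nf reg n σ f m (z m) (shift m) ∧ LatticeSideInputs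 Nf reg m (z m) (shift m)) := by
  sorry

/-- **Stub 3a-ii — the engine step (registered; PROVED by the wave-1 stub-worker over the packaged signature, rc 0 / 0 sorry; lands `--supports` once the Defs file is in the tree): the lattice-side input bundle implies
the compactness-ready bundle.**  Per tuple `m` and strictly increasing `φ` on which the countable family converges: (EXT) gives convergence on
all of `⁰𝒮` along `φ`; every eventual input passes to the subsequence; `exists_osData_qcd_of_package` applied to the reindexed scheme
`(reg.restrict φ _).scheme m (z m ∘ φ) (shift m ∘ φ)` with `Λ j := qcdLatticeDist sch (φ j)` (agreement on real tensors by
`qcdLatticeSchwinger_eq_qcdLatticeDist` and `qcdLatticeSchwinger_restrict_scheme`) returns OS data `T` with `IsQCDAlong`, non-triviality ×3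
and `T.HasMassGap Δ`; the convergence clause of `IsQCDAlong` is the closure clause's convergence. -/
theorem stub_compactnessReady_of_latticeInputs : (∀ Nf : ℕ, Nf = 2 ∨ Nf = 3 → ∀ reg : QCDRegularisation Nf, reg.HasMassScaling → (reg.scheme 0 0 0).HasAsymptoticScaling → (∀ m : Fin Nf → ℝ, (∀ f, 0 < m f) → PerMass Nf reg m) → (∀ m : Fin Nf → ℝ, (∀ f, 0 < m f) → ∃ Δ > 0, (reg.scheme m 0 0).HasLatticeMassGap Δ) → ∃ (z shift : (Fin Nf → ℝ) → QCDField Nf → ℕ → ℝ) (ι : Type) (_ : Countable ι) (n : ι → ℕ) (σ : (i : ι) → Fin (n i) → QCDField Nf) (f : (i : ι) → Fin (n i) → SchwartzMap (EuclideanSpace ℝ (Fin 4)) ℝ), (∀ i, n i ≠ 0) ∧ IsMassEquicontinuous reg z shift ∧ (∀ i, ∀ m : Fin Nf → ℝ, (∀ fl, 0 < m fl) → ∃ R : ℝ, ∀ᶠ k in atTop, ‖qcdLatticeSchwinger (reg.scheme m (z m) (shift m)) k (n i) (σ i) (f i)‖ ≤ R) ∧ (∀ m : Fin Nf → ℝ,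 (∀ fl, 0 < m fl) → LatticeExtInputs Nf reg n σ f m (z m) (shift m) ∧ LatticeSideInputs Nf reg m (z m) (shift m))) → ∀ Nf : ℕ, Nf = 2 ∨ Nf = 3 → ∀ reg : QCDRegularisation Nf, reg.HasMassScaling → (reg.scheme 0 0 0).HasAsymptoticScaling → (∀ m : Fin Nf → ℝ, (∀ f, 0 < m f) → PerMass Nf reg m) → (∀ m : Fin Nf → ℝ, (∀ f, 0 < m f) → ∃ Δ > 0, (reg.scheme m 0 0).HasLatticeMassGap Δ) → ∃ (z shift : (Fin Nf → ℝ) → QCDField Nf → ℕ → ℝ) (ι : Type) (_ : Countable ι) (n : ι → ℕ) (σ : (i : ι) → Fin (n i) → QCDField Nf) (f : (i : ι) → Fin (n i) → SchwartzMap (EuclideanSpace ℝ (Fin 4)) ℝ), (∀ i, n i ≠ 0) ∧ IsMassEquicontinuous reg z shift ∧ (∀ i, ∀ m : Fin Nf → ℝ, (∀ fl, 0 < m fl) → ∃ R : ℝ, ∀ᶠ k in atTop, ‖qcdLatticeSchwinger (reg.scheme m (z m) (shift m)) k (n i) (σ i) (f i)‖ ≤ R) ∧ (∀ m : Fin Nf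 → ℝ, (∀ fl, 0 < m fl) → CompactnessClosure Nf reg n σ f m (z m) (shift m)) := by
  sorry

/-- **Stub 3a — `PackageContinuum` in COMPACTNESS-READY form (child `PackageContinuum`'s content for the GIVEN
regularisation; rev 3: a THEOREM of stubs 3a-i/3a-ii).**  For `N_f ∈ {2,3}` and every AF, mass-scaling regularisation carrying the per-mass package and a lattice
gap at every positive tuple there are: species renormalisations `z m, shift m` chosen as functions of the mass tuple,
MASS-EQUICONTINUOUSLY (`IsMassEquicontinuous` — the Arzelà–Ascoli modulus, `DiagonalSpine.MassEquicontinuity`-shaped); a COUNTABLE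
family of test data `i ↦ (n i, σ i, f i)` on which the calibrated lattice `n`-point functions are eventually bounded in `k` at every
positive tuple (`DiagonalSpine.CalibratedTightness`-shaped k-uniform bounds); and the CLOSURE clause — at every positive tuple, along
EVERY strictly increasing `φ` on which that countable family converges, there are OS data `T` to whose Schwinger functions ALL lattice
`n`-point functions on off-diagonal real tensors converge along `φ` (density + E0′-equicontinuity; OS axioms E0′/E2/E3/E4 of the limit
by the scheme-generic engine `ConvergentOSClosure.stub_closureOfLatticeInputs` / `exists_osData_qcd_of_package` from the lattice-side
inputs T ∧ COMP, CL, CS; E1 = rotation restoration), with non-trivial non-Gaussian glue, dynamical flavour-changing pseudoscalars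
(eventual floors ×3) and a mass gap of `T`. -/
theorem stub_packageCompactnessReady : ∀ Nf : ℕ, Nf = 2 ∨ Nf = 3 → ∀ reg : QCDRegularisation Nf, reg.HasMassScaling → (reg.scheme 0 0 0).HasAsymptoticScaling → (∀ m : Fin Nf → ℝ, (∀ f, 0 < m f) → PerMass Nf reg m) → (∀ m : Fin Nf → ℝ, (∀ f, 0 < m f) → ∃ Δ > 0, (reg.scheme m 0 0).HasLatticeMassGap Δ) → ∃ (z shift : (Fin Nf → ℝ) → QCDField Nf → ℕ → ℝ) (ι : Type) (_ : Countable ι) (n : ι → ℕ) (σ : (i : ι) → Fin (n i) → QCDField Nf) (f : (i : ι) → Fin (n i) → SchwartzMap (EuclideanSpace ℝ (Fin 4)) ℝ), (∀ i, n i ≠ 0) ∧ IsMassEquicontinuous reg z shift ∧ (∀ i, ∀ m : Fin Nf → ℝ, (∀ fl, 0 < m fl) → ∃ R : ℝ, ∀ᶠ k in atTop, ‖qcdLatticeSchwinger (reg.scheme m (z m) (shift m)) k (n i) (σ i) (f i)‖ ≤ R) ∧ (∀ m : Fin Nf → ℝ, (∀ fl, 0 < m fl) → ∀ φ : ℕ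 → ℕ, StrictMono φ → (∀ i, ∃ l : ℂ, Tendsto (fun k => qcdLatticeSchwinger (reg.scheme m (z m) (shift m)) (φ k) (n i) (σ i) (f i)) atTop (𝓝 l)) → ∃ T : OSData (QCDField Nf) 4, (∀ n' : ℕ, n' ≠ 0 → ∀ (σ' : Fin n' → QCDField Nf) (f' : Fin n' → SchwartzMap (EuclideanSpace ℝ (Fin 4)) ℝ) (F : SchwartzMap (Fin n' → EuclideanSpace ℝ (Fin 4)) ℂ), IsTensorOf F (fun i => ofRealTest (f' i)) → IsOffDiagonal F → Tendsto (fun k => qcdLatticeSchwinger (reg.scheme m (z m) (shift m)) (φ k) n' σ' f') atTop (𝓝 (T.schwinger n' σ' F))) ∧ T.IsNontrivial QCDField.glue ∧ T.IsNonGaussian QCDField.glue ∧ (∀ f g : Fin Nf, f ≠ g → T.IsNontrivial (QCDField.pseudoRe f g)) ∧ ∃ Δ > 0, T.HasMassGap Δ) :=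
  stub_compactnessReady_of_latticeInputs stub_packageLatticeInputs

/-- **Stub 3b — the CLOSED diagonal step `stub_packageContinuum_of_compactnessReady`: LANDED** (lead c10, p163529,
`Theorems/WilsonMobilityGapChiralGluonicCompletionPackageContinuumOfCompactnessReady.lean`, commit a75ff499ab8c) as
`Summit.QuantumFields.QCD.Theorems.GoldstoneSplit.stub_packageContinuum_of_compactnessReady` (registered sub-goal).  Restated here with its
25-line proof only until the farm serves the new module's olean (then: import it and delete this copy); diagonal Arzelà–Ascoli
`exists_strictMono_forall_mass_tendsto` + `isQCDAlong_restrict_scheme` + clause (i) of `PerMass`. -/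
theorem stub_packageContinuum_of_compactnessReady : (∀ Nf : ℕ, Nf = 2 ∨ Nf = 3 → ∀ reg : QCDRegularisation Nf, reg.HasMassScaling → (reg.scheme 0 0 0).HasAsymptoticScaling → (∀ m : Fin Nf → ℝ, (∀ f, 0 < m f) → PerMass Nf reg m) → (∀ m : Fin Nf → ℝ, (∀ f, 0 < m f) → ∃ Δ > 0, (reg.scheme m 0 0).HasLatticeMassGap Δ) → ∃ (z shift : (Fin Nf → ℝ) → QCDField Nf → ℕ → ℝ) (ι : Type) (_ : Countable ι) (n : ι → ℕ) (σ : (i : ι) → Fin (n i) → QCDField Nf) (f : (i : ι) → Fin (n i) → SchwartzMap (EuclideanSpace ℝ (Fin 4)) ℝ), (∀ i, n i ≠ 0) ∧ IsMassEquicontinuous reg z shift ∧ (∀ i, ∀ m : Fin Nf → ℝ, (∀ fl, 0 < m fl) → ∃ R : ℝ, ∀ᶠ k in atTop, ‖qcdLatticeSchwinger (reg.scheme m (z m) (shift m)) k (n i) (σ i) (f i)‖ ≤ R) ∧ (∀ m : Fin Nf → ℝ, (∀ fl, 0 < m fl) → ∀ φ : ℕ → ℕ, StrictMono φ → (∀ i,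 ∃ l : ℂ, Tendsto (fun k => qcdLatticeSchwinger (reg.scheme m (z m) (shift m)) (φ k) (n i) (σ i) (f i)) atTop (𝓝 l)) → ∃ T : OSData (QCDField Nf) 4, (∀ n' : ℕ, n' ≠ 0 → ∀ (σ' : Fin n' → QCDField Nf) (f' : Fin n' → SchwartzMap (EuclideanSpace ℝ (Fin 4)) ℝ) (F : SchwartzMap (Fin n' → EuclideanSpace ℝ (Fin 4)) ℂ), IsTensorOf F (fun i => ofRealTest (f' i)) → IsOffDiagonal F → Tendsto (fun k => qcdLatticeSchwinger (reg.scheme m (z m) (shift m)) (φ k) n' σ' f') atTop (𝓝 (T.schwinger n' σ' F))) ∧ T.IsNontrivial QCDField.glue ∧ T.IsNonGaussian QCDField.glue ∧ (∀ f g : Fin Nf, f ≠ g → T.IsNontrivial (QCDField.pseudoRe f g)) ∧ ∃ Δ > 0, T.HasMassGap Δ)) → ∀ Nf : ℕ, Nf = 2 ∨ Nf = 3 → ∀ reg : QCDRegularisation Nf, reg.HasMassScaling → (reg.scheme 0 0 0).HasAsymptoticScaling → (∀ m : Fin Nf → ℝ, (∀ f, 0 < m f) → PerMass Nf reg m) →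 (∀ m : Fin Nf → ℝ, (∀ f, 0 < m f) → ∃ Δ > 0, (reg.scheme m 0 0).HasLatticeMassGap Δ) → ∃ φ : ℕ → ℕ, ∃ hφ : StrictMono φ, ∀ m : Fin Nf → ℝ, (∀ f, 0 < m f) → ContinuumBody Nf (reg.restrict φ hφ.tendsto_atTop) m := by
  intro hR Nf hNf reg hMS hAS hper hgap
  obtain ⟨z, shift, ι, hι, n, σ, f, hn, hE, hb, hC⟩ := hR Nf hNf reg hMS hAS hper hgap
  haveI : Countable ι := hι
  obtain ⟨φ, hφ, hlim⟩ :=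
    Summit.QuantumFields.QCD.Cruxes.ThinQCD.Registered.exists_strictMono_forall_mass_tendsto reg z shift hE n hn σ f hb
  refine ⟨φ, hφ, fun m hm => ?_⟩
  obtain ⟨T, hTconv, hN, hG, hP, hΔ⟩ := hC m hm φ hφ (hlim m hm)
  have hbr : ∀ fl, ∀ᶠ k in atTop, (-1 : ℝ) < (reg.scheme m 0 0).mq fl k := fun fl => by
    simpa only [QCDRegularisation.scheme_mq] using (hper m hm).1.1 fl
  exact ⟨fun s j => z m s (φ j), fun s j => shift m s (φ j), T,
    Summit.QuantumFields.QCD.Cruxes.ThinQCD.Registered.isQCDAlong_restrict_scheme reg φ hφ.tendsto_atTop hAS hbr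
      (z m) (shift m) T hTconv, hN, hG, hP, hΔ⟩

/-- **Stub 3 — `PackageContinuum`** (pin-free C2'; child `PackageContinuum` of the prepared split, text unchanged): such a
regularisation, gapped at every positive tuple, has ONE subsequence along which, at every positive tuple, calibrated lattice QCD
converges to OS data that are `IsQCDAlong`, non-trivial ×3 and continuum-gapped.  Rev 2: no longer a `sorry` — the compactness-ready
bundle (stub 3a) through the closed diagonal step (stub 3b). -/
theorem stub_packageContinuum : ∀ Nf : ℕ, Nf = 2 ∨ Nf = 3 → ∀ reg : QCDRegularisation Nf, reg.HasMassScaling → (reg.scheme 0 0 0).HasAsymptoticScaling → (∀ m : Fin Nf → ℝ, (∀ f, 0 < m f) → PerMass Nf reg m) → (∀ m : Fin Nf → ℝ, (∀ f, 0 < m f) → ∃ Δ > 0, (reg.scheme m 0 0).HasLatticeMassGap Δ) → ∃ φ : ℕ → ℕ, ∃ hφ : StrictMono φ, ∀ m : Fin Nf → ℝ, (∀ f, 0 < m f) → ContinuumBody Nf (reg.restrict φ hφ.tendsto_atTop) m :=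
  stub_packageContinuum_of_compactnessReady stub_packageCompactnessReady

/-! ## §2 The kernel-checked composition (concludes the crux BY NAME; no sorry below this line) -/

/-- **The glue `stub₁ → stub₂ → stub₃ →` (the crux, unfolded by `crux_iff`).**  The pin upgrade turns the typed witness into a
Goldstone package witness `reg`; the pin-free stubs 2–3, fed `reg`, are the two Goldstone stubs of p143054, whose composition completes
`reg.restrict φ` to a witness of `QCDOf N_f` — chiral at zero because `HasGoldstoneBound` restricts.  (Stated with the crux UNFOLDED so
that the registered skeleton theorem below is the only declaration concluding the route decl; the same term is attached as evidence
`split.lean` with the route decl as conclusion, for a prover to land under Theorems/ as the split's glue.) -/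
theorem qcdOf_of_stubs : (∀ Nf : ℕ, Nf = 2 ∨ Nf = 3 → (∃ reg : QCDRegularisation Nf, Hyp Nf reg) → ∃ reg : QCDRegularisation Nf, reg.HasMassScaling ∧ reg.HasGoldstoneBound ∧ (reg.scheme 0 0 0).HasAsymptoticScaling ∧ ∀ m : Fin Nf → ℝ, (∀ f, 0 < m f) → PerMass Nf reg m) → (∀ Nf : ℕ, Nf = 2 ∨ Nf = 3 → ∀ reg : QCDRegularisation Nf, reg.HasMassScaling → (reg.scheme 0 0 0).HasAsymptoticScaling → (∀ m : Fin Nf → ℝ, (∀ f, 0 < m f) → PerMass Nf reg m) → ∀ m : Fin Nf → ℝ, (∀ f, 0 < m f) → ∃ Δ > 0, (reg.scheme m 0 0).HasLatticeMassGap Δ) → (∀ Nf : ℕ, Nf = 2 ∨ Nf = 3 → ∀ reg : QCDRegularisation Nf, reg.HasMassScaling → (reg.scheme 0 0 0).HasAsymptoticScaling → (∀ m : Fin Nf → ℝ, (∀ f, 0 < m f) → PerMass Nf reg m) → (∀ m : Fin Nf → ℝ, (∀ f, 0 < m f) → ∃ Δ > 0, (reg.scheme m 0 0).HasLatticeMassGap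 Δ) → ∃ φ : ℕ → ℕ, ∃ hφ : StrictMono φ, ∀ m : Fin Nf → ℝ, (∀ f, 0 < m f) → ContinuumBody Nf (reg.restrict φ hφ.tendsto_atTop) m) →
    ∀ Nf : ℕ, Nf = 2 ∨ Nf = 3 → (∃ reg : QCDRegularisation Nf, Hyp Nf reg) → QCDOf Nf := by
  intro h₁ h₂ h₃ Nf hNf hC
  exact chiralGluonicCompletionGoldstone_of_goldstoneStubs
    (fun Nf hNf reg hG => h₂ Nf hNf reg hG.1 hG.2.2.1 hG.2.2.2)
    (fun Nf hNf reg hG hgap => h₃ Nf hNf reg hG.1 hG.2.2.1 hG.2.2.2 hgap) Nf hNf (h₁ Nf hNf hC)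

/-- **REGISTERED SKELETON THEOREM — the crux (WilsonMobilityGap copy, the item's primary decl) from the three stubs BY NAME.** -/
theorem WilsonMobilityGap_ChiralGluonicCompletion_of : WilsonMobilityGap.ChiralGluonicCompletion :=
  qcdOf_of_stubs stub_goldstonePinUpgrade stub_packageLatticeGap stub_packageContinuum

/-- The crux (PauliWegnerSea copy, rfl-equal) from the three stubs by name. -/
theorem ChiralGluonicCompletion_of : PauliWegnerSea.ChiralGluonicCompletion :=
  WilsonMobilityGap_ChiralGluonicCompletion_of

/-- The crux (GaussianLinkFrames copy, rfl-equal) from the three stubs by name. -/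
theorem GaussianLinkFrames_ChiralGluonicCompletion_of : GaussianLinkFrames.ChiralGluonicCompletion :=
  WilsonMobilityGap_ChiralGluonicCompletion_of

/-! ## §3 Calibration (sorry-free): where each stub sits -/

set_option maxHeartbeats 1600000 in
/-- **Stub 1 has a named supplier**: `MobilityGapPlus` (the registered line target of crux `ChiralMobilityGap`, stmt-17497; it delivers
package-carrying regularisations WITH the eventual Goldstone bound at `N_f = 2, 3`, `goldstone_of_mobilityGapPlus`, p136657) together with
`PhaseQuenchedFlavourDecay` (stmt-9151, for the PQFD half of the per-mass package) prove stub 1 outright — its typed hypothesis is not even used.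
So the honest lead outcome on stub 1 is `blocked-on: stmt-QuantumFields-17497 (line target MobilityGapPlus) ∧ stmt-QuantumFields-9151`. -/
theorem goldstonePinUpgrade_of_supplier (hM : MobilityGapPlus) (hD : PauliWegnerSea.PhaseQuenchedFlavourDecay) : ∀ Nf : ℕ, Nf = 2 ∨ Nf = 3 → (∃ reg : QCDRegularisation Nf, Hyp Nf reg) → ∃ reg : QCDRegularisation Nf, reg.HasMassScaling ∧ reg.HasGoldstoneBound ∧ (reg.scheme 0 0 0).HasAsymptoticScaling ∧ ∀ m : Fin Nf → ℝ, (∀ f, 0 < m f) → PerMass Nf reg m := by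
  intro Nf hNf _
  obtain ⟨⟨reg₂, hC₂, hG₂⟩, ⟨reg₃, hC₃, hG₃⟩⟩ := goldstone_of_mobilityGapPlus hM
  -- unfold `Clauses` ONCE per flavour number (it is a `def`; repeated projections through it are expensive)
  have hC₂' : reg₂.HasMassScaling ∧ (reg₂.scheme 0 0 0).HasAsymptoticScaling ∧ ∀ m : Fin 2 → ℝ, (∀ f, 0 < m f) →
      ClauseI 2 reg₂ m ∧ ClauseII 2 reg₂ m ∧ ClauseIII 2 reg₂ m ∧ ClauseIV 2 reg₂ m := hC₂
  have hC₃' : reg₃.HasMassScaling ∧ (reg₃.scheme 0 0 0).HasAsymptoticScaling ∧ ∀ m : Fin 3 → ℝ, (∀ f, 0 < m f) →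
      ClauseI 3 reg₃ m ∧ ClauseII 3 reg₃ m ∧ ClauseIII 3 reg₃ m ∧ ClauseIV 3 reg₃ m := hC₃
  obtain ⟨hMS₂, hAS₂, hper₂⟩ := hC₂'
  obtain ⟨hMS₃, hAS₃, hper₃⟩ := hC₃'
  have hD₂ : ∀ m : Fin 2 → ℝ, (∀ f, 0 < m f) → ClauseII 2 reg₂ m → PQFD 2 reg₂ m := fun m hm h => hD 2 reg₂ m hm h
  have hD₃ : ∀ m : Fin 3 → ℝ, (∀ f, 0 < m f) → ClauseII 3 reg₃ m → PQFD 3 reg₃ m := fun m hm h => hD 3 reg₃ m hm h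
  rcases hNf with rfl | rfl
  · exact ⟨reg₂, hMS₂, hG₂, hAS₂, fun m hm => ⟨hper₂ m hm, hD₂ m hm (hper₂ m hm).2.1⟩⟩
  · exact ⟨reg₃, hMS₃, hG₃, hAS₃, fun m hm => ⟨hper₃ m hm, hD₃ m hm (hper₃ m hm).2.1⟩⟩

/-- **Stub 1 is WEAKER than the dead stub E\* (given C1)**: a hereditarily pinned subsequence of a gapped `Hyp`-witness has a Goldstone
sub-subsequence (`exists_restrict_hasGoldstoneBound_of_hereditaryPin`, p137857), along which the whole package rides (`hyp_restrict`). -/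
theorem goldstonePinUpgrade_of_hereditaryPin (hE : ∀ Nf : ℕ, Nf = 2 ∨ Nf = 3 → ∀ reg : QCDRegularisation Nf, Hyp Nf reg → ∃ φ : ℕ → ℕ, ∃ hφ : StrictMono φ, ∀ (ψ : ℕ → ℕ) (hψ : StrictMono ψ), ((reg.restrict φ hφ.tendsto_atTop).restrict ψ hψ.tendsto_atTop).IsChiralAtZero) (hC1 : ∀ Nf : ℕ, Nf = 2 ∨ Nf = 3 → ∀ reg : QCDRegularisation Nf, Hyp Nf reg → ∀ m : Fin Nf → ℝ, (∀ f, 0 < m f) → ∃ Δ > 0, (reg.scheme m 0 0).HasLatticeMassGap Δ) : ∀ Nf : ℕ, Nf = 2 ∨ Nf = 3 → (∃ reg : QCDRegularisation Nf, Hyp Nf reg) → ∃ reg : QCDRegularisation Nf, reg.HasMassScaling ∧ reg.HasGoldstoneBound ∧ (reg.scheme 0 0 0).HasAsymptoticScaling ∧ ∀ m : Fin Nf → ℝ, (∀ f, 0 < m f) → PerMass Nf reg m := by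
  rintro Nf hNf ⟨reg, hH⟩
  obtain ⟨φ, hφ, hher⟩ := hE Nf hNf reg hH
  obtain ⟨θ, hθ, hG⟩ := exists_restrict_hasGoldstoneBound_of_hereditaryPin reg φ hφ hher (hC1 Nf hNf reg hH)
  have hH' := hyp_restrict reg θ hθ hH hG
  exact ⟨reg.restrict θ hθ.tendsto_atTop, hH'.1, hG, hH'.2.2.1, hH'.2.2.2⟩

/-- **Stub 2 implies the typed C1** of line `Sketch` (a `Hyp`-witness is a package witness; the pin is idle for the gap). -/
theorem typedLatticeGap_of_packageLatticeGap (h₂ : ∀ Nf : ℕ, Nf = 2 ∨ Nf = 3 → ∀ reg : QCDRegularisation Nf, reg.HasMassScaling → (reg.scheme 0 0 0).HasAsymptoticScaling → (∀ m : Fin Nf → ℝ, (∀ f, 0 < m f) → PerMass Nf reg m) → ∀ m : Fin Nf → ℝ, (∀ f, 0 < m f) → ∃ Δ > 0, (reg.scheme m 0 0).HasLatticeMassGap Δ) : ∀ Nf : ℕ, Nf = 2 ∨ Nf = 3 → ∀ reg : QCDRegularisation Nf, Hyp Nf reg → ∀ m : Fin Nf → ℝ, (∀ f, 0 < m f) →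 ∃ Δ > 0, (reg.scheme m 0 0).HasLatticeMassGap Δ :=
  fun Nf hNf reg hH => h₂ Nf hNf reg hH.1 hH.2.2.1 hH.2.2.2

/-- **Stub 3 implies the typed C2'** of line `Sketch`. -/
theorem typedContinuum_of_packageContinuum (h₃ : ∀ Nf : ℕ, Nf = 2 ∨ Nf = 3 → ∀ reg : QCDRegularisation Nf, reg.HasMassScaling → (reg.scheme 0 0 0).HasAsymptoticScaling → (∀ m : Fin Nf → ℝ, (∀ f, 0 < m f) → PerMass Nf reg m) → (∀ m : Fin Nf → ℝ, (∀ f, 0 < m f) → ∃ Δ > 0, (reg.scheme m 0 0).HasLatticeMassGap Δ) → ∃ φ : ℕ → ℕ, ∃ hφ : StrictMono φ, ∀ m : Fin Nf → ℝ, (∀ f, 0 < m f) → ContinuumBody Nf (reg.restrict φ hφ.tendsto_atTop) m) : ∀ Nf : ℕ, Nf = 2 ∨ Nf = 3 → ∀ reg : QCDRegularisation Nf, Hyp Nf reg → (∀ m : Fin Nf → ℝ, (∀ f, 0 < m f) → ∃ Δ > 0, (reg.scheme m 0 0).HasLatticeMassGap Δ) → ∃ φ : ℕ → ℕ, ∃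 hφ : StrictMono φ, ∀ m : Fin Nf → ℝ, (∀ f, 0 < m f) → ContinuumBody Nf (reg.restrict φ hφ.tendsto_atTop) m :=
  fun Nf hNf reg hH => h₃ Nf hNf reg hH.1 hH.2.2.1 hH.2.2.2

/-! ### The stub signatures are, definitionally, the three statements of the strategist's `children.json`
(inlined over Literature vocabulary so that they can be filed as route items by `route edit --split`). -/

/-- Stub 1 ↔ child `GoldstonePinUpgrade` (inlined text). -/
theorem stub₁_iff_child : (∀ Nf : ℕ, Nf = 2 ∨ Nf = 3 → (∃ reg : QCDRegularisation Nf, Hyp Nf reg) → ∃ reg : QCDRegularisation Nf, reg.HasMassScaling ∧ reg.HasGoldstoneBound ∧ (reg.scheme 0 0 0).HasAsymptoticScaling ∧ ∀ m : Fin Nf → ℝ, (∀ f, 0 < m f) → PerMass Nf reg m) ↔ (∀ Nf : ℕ, Nf = 2 ∨ Nf = 3 → (∃ reg : QCDRegularisation Nf, reg.HasMassScaling ∧ reg.IsChiralAtZero ∧ (reg.scheme 0 0 0).HasAsymptoticScaling ∧ ∀ m : Fin Nf → ℝ, (∀ f, 0 < m f) → ((∀ f : Fin Nf, ∀ᶠ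 k in atTop, -1 < reg.mcrit k + reg.a k * m f / reg.Zm k) ∧ (∃ s δ C : ℝ, 0 < s ∧ s < 1 ∧ 0 < δ ∧ ∀ᶠ k in atTop, ∀ S : ℕ, reg.L k ≤ S → ∀ (f : Fin Nf) (v : Literature.Probability.LatticeModels.Site 4), v ∈ box 4 S → (∫ U : GaugeConfig 4 (2 * S + 1) (Matrix.specialUnitaryGroup (Fin 3) ℂ), ‖(diracMatrix U fun fl => reg.mcrit k + reg.a k * m fl / reg.Zm k).det‖ * (∑ a : Fin 3, ∑ i : Fin 4, ∑ b : Fin 3, ∑ j : Fin 4, ‖(diracMatrix U fun fl => reg.mcrit k + reg.a k * m fl / reg.Zm k)⁻¹ (quarkEquiv (f, (Torus.proj (2 * S + 1) 0, a, i))) (quarkEquiv (f, (Torus.proj (2 * S + 1) (v), b, j)))‖) ^ s ∂(wilsonMeasure (fundamentalRep (Fin 3)) (reg.β k))) / (∫ U : GaugeConfig 4 (2 * S + 1) (Matrix.specialUnitaryGroup (Fin 3) ℂ), ‖(diracMatrix U fun fl => reg.mcrit k + reg.a k * m fl / reg.Zm k).det‖ ∂(wilsonMeasure (fundamentalRep (Fin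 3)) (reg.β k))) ≤ C * Real.exp (-(δ * (reg.a k * ‖v‖)))) ∧ (∃ s c₀ C₁ p : ℝ, 0 < s ∧ s < 1 ∧ 0 < c₀ ∧ ∀ᶠ k in atTop, ∀ S : ℕ, reg.L k ≤ S → ∀ (f : Fin Nf) (n : ℕ), n ≤ S → c₀ * Real.exp (-(C₁ * (reg.a k * n) + p * Real.log (n + 1))) ≤ (∫ U : GaugeConfig 4 (2 * S + 1) (Matrix.specialUnitaryGroup (Fin 3) ℂ), ‖(diracMatrix U fun fl => reg.mcrit k + reg.a k * m fl / reg.Zm k).det‖ * (∑ a : Fin 3, ∑ i : Fin 4, ∑ b : Fin 3, ∑ j : Fin 4, ‖(diracMatrix U fun fl => reg.mcrit k + reg.a k * m fl / reg.Zm k)⁻¹ (quarkEquiv (f, (Torus.proj (2 * S + 1) 0, a, i))) (quarkEquiv (f, (Torus.proj (2 * S + 1) (Pi.single 0 (n : ℤ)), b, j)))‖) ^ s ∂(wilsonMeasure (fundamentalRep (Fin 3)) (reg.β k))) / (∫ U : GaugeConfig 4 (2 * S + 1) (Matrix.specialUnitaryGroup (Fin 3) ℂ), ‖(diracMatrix U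 fun fl => reg.mcrit k + reg.a k * m fl / reg.Zm k).det‖ ∂(wilsonMeasure (fundamentalRep (Fin 3)) (reg.β k)))) ∧ (∀ᶠ k in atTop, (1 / 2 : ℝ) ≤ ‖∫ U : GaugeConfig 4 (2 * reg.L k + 1) (Matrix.specialUnitaryGroup (Fin 3) ℂ), (diracMatrix U fun fl => reg.mcrit k + reg.a k * m fl / reg.Zm k).det ∂(wilsonMeasure (fundamentalRep (Fin 3)) (reg.β k))‖ / (∫ U : GaugeConfig 4 (2 * reg.L k + 1) (Matrix.specialUnitaryGroup (Fin 3) ℂ), ‖(diracMatrix U fun fl => reg.mcrit k + reg.a k * m fl / reg.Zm k).det‖ ∂(wilsonMeasure (fundamentalRep (Fin 3)) (reg.β k))))) ∧ (∃ δ' : ℝ, 0 < δ' ∧ ∀ (R R' : ℕ) (A : QCDLatticeObservable Nf R) (B : QCDLatticeObservable Nf R'), (∃ (f₀ : Fin Nf) (q : ℤ), q ≠ 0 ∧ ∀ (θ : ℝ) (U : LGConfig 4 (Matrix.specialUnitaryGroup (Fin 3) ℂ)), ExteriorAlgebra.map (LinearMap.pi fun w => (Sum.elim (fun i => if (boxQuarkEquiv.symm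 i).1 = f₀ then Complex.exp (-((θ : ℂ) * Complex.I)) else 1) (fun i => if (boxQuarkEquiv.symm i).1 = f₀ then Complex.exp ((θ : ℂ) * Complex.I) else 1) (ofLex w)) • LinearMap.proj w) (A.F U) = Complex.exp (((q : ℝ) * θ : ℝ) * Complex.I) • A.F U) → ∃ C' : ℝ, ∀ᶠ k in atTop, ∀ S : ℕ, reg.L k ≤ S → ∀ n : ℕ, n ≤ S → ‖(∫ U : GaugeConfig 4 (2 * S + 1) (Matrix.specialUnitaryGroup (Fin 3) ℂ), (‖(diracMatrix U fun fl => reg.mcrit k + reg.a k * m fl / reg.Zm k).det‖ : ℂ) * (fermiIntegral (A.onTorus (2 * S + 1) 0 U * B.onTorus (2 * S + 1) (Pi.single 0 (n : ℤ)) U * fermiBoltzmann U fun fl => reg.mcrit k + reg.a k * m fl / reg.Zm k) / fermiIntegral (fermiBoltzmann U fun fl => reg.mcrit k + reg.a k * m fl / reg.Zm k)) ∂(wilsonMeasure (fundamentalRep (Fin 3)) (reg.β k))) / (∫ U : GaugeConfig 4 (2 * S + 1) (Matrix.specialUnitaryGroup (Fin 3) ℂ), (‖(diracMatrix U fun fl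 => reg.mcrit k + reg.a k * m fl / reg.Zm k).det‖ : ℂ) ∂(wilsonMeasure (fundamentalRep (Fin 3)) (reg.β k)))‖ ≤ C' * Real.exp (-(δ' * (reg.a k * n))))) → ∃ reg : QCDRegularisation Nf, reg.HasMassScaling ∧ QCDRegularisation.HasGoldstoneBound reg ∧ (reg.scheme 0 0 0).HasAsymptoticScaling ∧ ∀ m : Fin Nf → ℝ, (∀ f, 0 < m f) → ((∀ f : Fin Nf, ∀ᶠ k in atTop, -1 < reg.mcrit k + reg.a k * m f / reg.Zm k) ∧ (∃ s δ C : ℝ, 0 < s ∧ s < 1 ∧ 0 < δ ∧ ∀ᶠ k in atTop, ∀ S : ℕ, reg.L k ≤ S → ∀ (f : Fin Nf) (v : Literature.Probability.LatticeModels.Site 4), v ∈ box 4 S → (∫ U : GaugeConfig 4 (2 * S + 1) (Matrix.specialUnitaryGroup (Fin 3) ℂ), ‖(diracMatrix U fun fl => reg.mcrit k + reg.a k * m fl / reg.Zm k).det‖ * (∑ a : Fin 3, ∑ i : Fin 4, ∑ b : Fin 3, ∑ j : Fin 4, ‖(diracMatrix U fun fl => reg.mcrit k + reg.a k * m fl /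 reg.Zm k)⁻¹ (quarkEquiv (f, (Torus.proj (2 * S + 1) 0, a, i))) (quarkEquiv (f, (Torus.proj (2 * S + 1) (v), b, j)))‖) ^ s ∂(wilsonMeasure (fundamentalRep (Fin 3)) (reg.β k))) / (∫ U : GaugeConfig 4 (2 * S + 1) (Matrix.specialUnitaryGroup (Fin 3) ℂ), ‖(diracMatrix U fun fl => reg.mcrit k + reg.a k * m fl / reg.Zm k).det‖ ∂(wilsonMeasure (fundamentalRep (Fin 3)) (reg.β k))) ≤ C * Real.exp (-(δ * (reg.a k * ‖v‖)))) ∧ (∃ s c₀ C₁ p : ℝ, 0 < s ∧ s < 1 ∧ 0 < c₀ ∧ ∀ᶠ k in atTop, ∀ S : ℕ, reg.L k ≤ S → ∀ (f : Fin Nf) (n : ℕ), n ≤ S → c₀ * Real.exp (-(C₁ * (reg.a k * n) + p * Real.log (n + 1))) ≤ (∫ U : GaugeConfig 4 (2 * S + 1) (Matrix.specialUnitaryGroup (Fin 3) ℂ), ‖(diracMatrix U fun fl => reg.mcrit k + reg.a k * m fl / reg.Zm k).det‖ * (∑ a : Fin 3, ∑ i : Fin 4, ∑ b : Fin 3, ∑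 j : Fin 4, ‖(diracMatrix U fun fl => reg.mcrit k + reg.a k * m fl / reg.Zm k)⁻¹ (quarkEquiv (f, (Torus.proj (2 * S + 1) 0, a, i))) (quarkEquiv (f, (Torus.proj (2 * S + 1) (Pi.single 0 (n : ℤ)), b, j)))‖) ^ s ∂(wilsonMeasure (fundamentalRep (Fin 3)) (reg.β k))) / (∫ U : GaugeConfig 4 (2 * S + 1) (Matrix.specialUnitaryGroup (Fin 3) ℂ), ‖(diracMatrix U fun fl => reg.mcrit k + reg.a k * m fl / reg.Zm k).det‖ ∂(wilsonMeasure (fundamentalRep (Fin 3)) (reg.β k)))) ∧ (∀ᶠ k in atTop, (1 / 2 : ℝ) ≤ ‖∫ U : GaugeConfig 4 (2 * reg.L k + 1) (Matrix.specialUnitaryGroup (Fin 3) ℂ), (diracMatrix U fun fl => reg.mcrit k + reg.a k * m fl / reg.Zm k).det ∂(wilsonMeasure (fundamentalRep (Fin 3)) (reg.β k))‖ / (∫ U : GaugeConfig 4 (2 * reg.L k + 1) (Matrix.specialUnitaryGroup (Fin 3) ℂ), ‖(diracMatrix U fun fl => reg.mcrit k + reg.a k * m fl / reg.Zm k).det‖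 ∂(wilsonMeasure (fundamentalRep (Fin 3)) (reg.β k))))) ∧ (∃ δ' : ℝ, 0 < δ' ∧ ∀ (R R' : ℕ) (A : QCDLatticeObservable Nf R) (B : QCDLatticeObservable Nf R'), (∃ (f₀ : Fin Nf) (q : ℤ), q ≠ 0 ∧ ∀ (θ : ℝ) (U : LGConfig 4 (Matrix.specialUnitaryGroup (Fin 3) ℂ)), ExteriorAlgebra.map (LinearMap.pi fun w => (Sum.elim (fun i => if (boxQuarkEquiv.symm i).1 = f₀ then Complex.exp (-((θ : ℂ) * Complex.I)) else 1) (fun i => if (boxQuarkEquiv.symm i).1 = f₀ then Complex.exp ((θ : ℂ) * Complex.I) else 1) (ofLex w)) • LinearMap.proj w) (A.F U) = Complex.exp (((q : ℝ) * θ : ℝ) * Complex.I) • A.F U) → ∃ C' : ℝ, ∀ᶠ k in atTop, ∀ S : ℕ, reg.L k ≤ S → ∀ n : ℕ, n ≤ S → ‖(∫ U : GaugeConfig 4 (2 * S + 1) (Matrix.specialUnitaryGroup (Fin 3) ℂ), (‖(diracMatrix U fun fl => reg.mcrit k + reg.a k * m fl / reg.Zm k).det‖ : ℂ) * (fermiIntegral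 (A.onTorus (2 * S + 1) 0 U * B.onTorus (2 * S + 1) (Pi.single 0 (n : ℤ)) U * fermiBoltzmann U fun fl => reg.mcrit k + reg.a k * m fl / reg.Zm k) / fermiIntegral (fermiBoltzmann U fun fl => reg.mcrit k + reg.a k * m fl / reg.Zm k)) ∂(wilsonMeasure (fundamentalRep (Fin 3)) (reg.β k))) / (∫ U : GaugeConfig 4 (2 * S + 1) (Matrix.specialUnitaryGroup (Fin 3) ℂ), (‖(diracMatrix U fun fl => reg.mcrit k + reg.a k * m fl / reg.Zm k).det‖ : ℂ) ∂(wilsonMeasure (fundamentalRep (Fin 3)) (reg.β k)))‖ ≤ C' * Real.exp (-(δ' * (reg.a k * n))))) := Iff.rfl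

/-- Stub 2 ↔ child `PackageLatticeGap` (inlined text). -/
theorem stub₂_iff_child : (∀ Nf : ℕ, Nf = 2 ∨ Nf = 3 → ∀ reg : QCDRegularisation Nf, reg.HasMassScaling → (reg.scheme 0 0 0).HasAsymptoticScaling → (∀ m : Fin Nf → ℝ, (∀ f, 0 < m f) → PerMass Nf reg m) → ∀ m : Fin Nf → ℝ, (∀ f, 0 < m f) → ∃ Δ > 0, (reg.scheme m 0 0).HasLatticeMassGap Δ) ↔ (∀ Nf : ℕ, Nf = 2 ∨ Nf = 3 → ∀ reg : QCDRegularisation Nf, reg.HasMassScaling → (reg.scheme 0 0 0).HasAsymptoticScaling → (∀ m : Fin Nf → ℝ, (∀ f, 0 < m f) → ((∀ f : Fin Nf, ∀ᶠ k in atTop, -1 < reg.mcrit k + reg.a k * m f / reg.Zm k) ∧ (∃ s δ C : ℝ, 0 < s ∧ s < 1 ∧ 0 < δ ∧ ∀ᶠ k in atTop, ∀ S : ℕ, reg.L k ≤ S → ∀ (f : Fin Nf) (v : Literature.Probability.LatticeModels.Site 4), v ∈ box 4 S → (∫ U : GaugeConfig 4 (2 * S + 1) (Matrix.specialUnitaryGroup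 (Fin 3) ℂ), ‖(diracMatrix U fun fl => reg.mcrit k + reg.a k * m fl / reg.Zm k).det‖ * (∑ a : Fin 3, ∑ i : Fin 4, ∑ b : Fin 3, ∑ j : Fin 4, ‖(diracMatrix U fun fl => reg.mcrit k + reg.a k * m fl / reg.Zm k)⁻¹ (quarkEquiv (f, (Torus.proj (2 * S + 1) 0, a, i))) (quarkEquiv (f, (Torus.proj (2 * S + 1) (v), b, j)))‖) ^ s ∂(wilsonMeasure (fundamentalRep (Fin 3)) (reg.β k))) / (∫ U : GaugeConfig 4 (2 * S + 1) (Matrix.specialUnitaryGroup (Fin 3) ℂ), ‖(diracMatrix U fun fl => reg.mcrit k + reg.a k * m fl / reg.Zm k).det‖ ∂(wilsonMeasure (fundamentalRep (Fin 3)) (reg.β k))) ≤ C * Real.exp (-(δ * (reg.a k * ‖v‖)))) ∧ (∃ s c₀ C₁ p : ℝ, 0 < s ∧ s < 1 ∧ 0 < c₀ ∧ ∀ᶠ k in atTop, ∀ S : ℕ, reg.L k ≤ S → ∀ (f : Fin Nf) (n : ℕ), n ≤ S → c₀ * Real.exp (-(C₁ * (reg.a k * n) + p * Real.log (n + 1)))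 ≤ (∫ U : GaugeConfig 4 (2 * S + 1) (Matrix.specialUnitaryGroup (Fin 3) ℂ), ‖(diracMatrix U fun fl => reg.mcrit k + reg.a k * m fl / reg.Zm k).det‖ * (∑ a : Fin 3, ∑ i : Fin 4, ∑ b : Fin 3, ∑ j : Fin 4, ‖(diracMatrix U fun fl => reg.mcrit k + reg.a k * m fl / reg.Zm k)⁻¹ (quarkEquiv (f, (Torus.proj (2 * S + 1) 0, a, i))) (quarkEquiv (f, (Torus.proj (2 * S + 1) (Pi.single 0 (n : ℤ)), b, j)))‖) ^ s ∂(wilsonMeasure (fundamentalRep (Fin 3)) (reg.β k))) / (∫ U : GaugeConfig 4 (2 * S + 1) (Matrix.specialUnitaryGroup (Fin 3) ℂ), ‖(diracMatrix U fun fl => reg.mcrit k + reg.a k * m fl / reg.Zm k).det‖ ∂(wilsonMeasure (fundamentalRep (Fin 3)) (reg.β k)))) ∧ (∀ᶠ k in atTop, (1 / 2 : ℝ) ≤ ‖∫ U : GaugeConfig 4 (2 * reg.L k + 1) (Matrix.specialUnitaryGroup (Fin 3) ℂ), (diracMatrix U fun fl => reg.mcrit k + reg.a k * m fl / reg.Zm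 k).det ∂(wilsonMeasure (fundamentalRep (Fin 3)) (reg.β k))‖ / (∫ U : GaugeConfig 4 (2 * reg.L k + 1) (Matrix.specialUnitaryGroup (Fin 3) ℂ), ‖(diracMatrix U fun fl => reg.mcrit k + reg.a k * m fl / reg.Zm k).det‖ ∂(wilsonMeasure (fundamentalRep (Fin 3)) (reg.β k))))) ∧ (∃ δ' : ℝ, 0 < δ' ∧ ∀ (R R' : ℕ) (A : QCDLatticeObservable Nf R) (B : QCDLatticeObservable Nf R'), (∃ (f₀ : Fin Nf) (q : ℤ), q ≠ 0 ∧ ∀ (θ : ℝ) (U : LGConfig 4 (Matrix.specialUnitaryGroup (Fin 3) ℂ)), ExteriorAlgebra.map (LinearMap.pi fun w => (Sum.elim (fun i => if (boxQuarkEquiv.symm i).1 = f₀ then Complex.exp (-((θ : ℂ) * Complex.I)) else 1) (fun i => if (boxQuarkEquiv.symm i).1 = f₀ then Complex.exp ((θ : ℂ) * Complex.I) else 1) (ofLex w)) • LinearMap.proj w) (A.F U) = Complex.exp (((q : ℝ) * θ : ℝ) * Complex.I) • A.F U) → ∃ C' : ℝ, ∀ᶠ k in atTop, ∀ S : ℕ,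 reg.L k ≤ S → ∀ n : ℕ, n ≤ S → ‖(∫ U : GaugeConfig 4 (2 * S + 1) (Matrix.specialUnitaryGroup (Fin 3) ℂ), (‖(diracMatrix U fun fl => reg.mcrit k + reg.a k * m fl / reg.Zm k).det‖ : ℂ) * (fermiIntegral (A.onTorus (2 * S + 1) 0 U * B.onTorus (2 * S + 1) (Pi.single 0 (n : ℤ)) U * fermiBoltzmann U fun fl => reg.mcrit k + reg.a k * m fl / reg.Zm k) / fermiIntegral (fermiBoltzmann U fun fl => reg.mcrit k + reg.a k * m fl / reg.Zm k)) ∂(wilsonMeasure (fundamentalRep (Fin 3)) (reg.β k))) / (∫ U : GaugeConfig 4 (2 * S + 1) (Matrix.specialUnitaryGroup (Fin 3) ℂ), (‖(diracMatrix U fun fl => reg.mcrit k + reg.a k * m fl / reg.Zm k).det‖ : ℂ) ∂(wilsonMeasure (fundamentalRep (Fin 3)) (reg.β k)))‖ ≤ C' * Real.exp (-(δ' * (reg.a k * n))))) → ∀ m : Fin Nf → ℝ, (∀ f, 0 < m f) → ∃ Δ > 0, (reg.scheme m 0 0).HasLatticeMassGap Δ) := Iff.rfl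

/-- Stub 3 ↔ child `PackageContinuum` (inlined text). -/
theorem stub₃_iff_child : (∀ Nf : ℕ, Nf = 2 ∨ Nf = 3 → ∀ reg : QCDRegularisation Nf, reg.HasMassScaling → (reg.scheme 0 0 0).HasAsymptoticScaling → (∀ m : Fin Nf → ℝ, (∀ f, 0 < m f) → PerMass Nf reg m) → (∀ m : Fin Nf → ℝ, (∀ f, 0 < m f) → ∃ Δ > 0, (reg.scheme m 0 0).HasLatticeMassGap Δ) → ∃ φ : ℕ → ℕ, ∃ hφ : StrictMono φ, ∀ m : Fin Nf → ℝ, (∀ f, 0 < m f) → ContinuumBody Nf (reg.restrict φ hφ.tendsto_atTop) m) ↔ (∀ Nf : ℕ, Nf = 2 ∨ Nf = 3 → ∀ reg : QCDRegularisation Nf, reg.HasMassScaling → (reg.scheme 0 0 0).HasAsymptoticScaling → (∀ m : Fin Nf → ℝ, (∀ f, 0 < m f) → ((∀ f : Fin Nf, ∀ᶠ k in atTop, -1 < reg.mcrit k + reg.a k * m f / reg.Zm k) ∧ (∃ s δ C : ℝ, 0 < s ∧ s < 1 ∧ 0 < δ ∧ ∀ᶠ k in atTop, ∀ S : ℕ,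 reg.L k ≤ S → ∀ (f : Fin Nf) (v : Literature.Probability.LatticeModels.Site 4), v ∈ box 4 S → (∫ U : GaugeConfig 4 (2 * S + 1) (Matrix.specialUnitaryGroup (Fin 3) ℂ), ‖(diracMatrix U fun fl => reg.mcrit k + reg.a k * m fl / reg.Zm k).det‖ * (∑ a : Fin 3, ∑ i : Fin 4, ∑ b : Fin 3, ∑ j : Fin 4, ‖(diracMatrix U fun fl => reg.mcrit k + reg.a k * m fl / reg.Zm k)⁻¹ (quarkEquiv (f, (Torus.proj (2 * S + 1) 0, a, i))) (quarkEquiv (f, (Torus.proj (2 * S + 1) (v), b, j)))‖) ^ s ∂(wilsonMeasure (fundamentalRep (Fin 3)) (reg.β k))) / (∫ U : GaugeConfig 4 (2 * S + 1) (Matrix.specialUnitaryGroup (Fin 3) ℂ), ‖(diracMatrix U fun fl => reg.mcrit k + reg.a k * m fl / reg.Zm k).det‖ ∂(wilsonMeasure (fundamentalRep (Fin 3)) (reg.β k))) ≤ C * Real.exp (-(δ * (reg.a k * ‖v‖)))) ∧ (∃ s c₀ C₁ p : ℝ, 0 < s ∧ s < 1 ∧ 0 < c₀ ∧ ∀ᶠ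 k in atTop, ∀ S : ℕ, reg.L k ≤ S → ∀ (f : Fin Nf) (n : ℕ), n ≤ S → c₀ * Real.exp (-(C₁ * (reg.a k * n) + p * Real.log (n + 1))) ≤ (∫ U : GaugeConfig 4 (2 * S + 1) (Matrix.specialUnitaryGroup (Fin 3) ℂ), ‖(diracMatrix U fun fl => reg.mcrit k + reg.a k * m fl / reg.Zm k).det‖ * (∑ a : Fin 3, ∑ i : Fin 4, ∑ b : Fin 3, ∑ j : Fin 4, ‖(diracMatrix U fun fl => reg.mcrit k + reg.a k * m fl / reg.Zm k)⁻¹ (quarkEquiv (f, (Torus.proj (2 * S + 1) 0, a, i))) (quarkEquiv (f, (Torus.proj (2 * S + 1) (Pi.single 0 (n : ℤ)), b, j)))‖) ^ s ∂(wilsonMeasure (fundamentalRep (Fin 3)) (reg.β k))) / (∫ U : GaugeConfig 4 (2 * S + 1) (Matrix.specialUnitaryGroup (Fin 3) ℂ), ‖(diracMatrix U fun fl => reg.mcrit k + reg.a k * m fl / reg.Zm k).det‖ ∂(wilsonMeasure (fundamentalRep (Fin 3)) (reg.β k)))) ∧ (∀ᶠ k in atTop, (1 / 2 : ℝ) ≤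 ‖∫ U : GaugeConfig 4 (2 * reg.L k + 1) (Matrix.specialUnitaryGroup (Fin 3) ℂ), (diracMatrix U fun fl => reg.mcrit k + reg.a k * m fl / reg.Zm k).det ∂(wilsonMeasure (fundamentalRep (Fin 3)) (reg.β k))‖ / (∫ U : GaugeConfig 4 (2 * reg.L k + 1) (Matrix.specialUnitaryGroup (Fin 3) ℂ), ‖(diracMatrix U fun fl => reg.mcrit k + reg.a k * m fl / reg.Zm k).det‖ ∂(wilsonMeasure (fundamentalRep (Fin 3)) (reg.β k))))) ∧ (∃ δ' : ℝ, 0 < δ' ∧ ∀ (R R' : ℕ) (A : QCDLatticeObservable Nf R) (B : QCDLatticeObservable Nf R'), (∃ (f₀ : Fin Nf) (q : ℤ), q ≠ 0 ∧ ∀ (θ : ℝ) (U : LGConfig 4 (Matrix.specialUnitaryGroup (Fin 3) ℂ)), ExteriorAlgebra.map (LinearMap.pi fun w => (Sum.elim (fun i => if (boxQuarkEquiv.symm i).1 = f₀ then Complex.exp (-((θ : ℂ) * Complex.I)) else 1) (fun i => if (boxQuarkEquiv.symm i).1 = f₀ then Complex.exp ((θ : ℂ) * Complex.I) else 1) (ofLex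 w)) • LinearMap.proj w) (A.F U) = Complex.exp (((q : ℝ) * θ : ℝ) * Complex.I) • A.F U) → ∃ C' : ℝ, ∀ᶠ k in atTop, ∀ S : ℕ, reg.L k ≤ S → ∀ n : ℕ, n ≤ S → ‖(∫ U : GaugeConfig 4 (2 * S + 1) (Matrix.specialUnitaryGroup (Fin 3) ℂ), (‖(diracMatrix U fun fl => reg.mcrit k + reg.a k * m fl / reg.Zm k).det‖ : ℂ) * (fermiIntegral (A.onTorus (2 * S + 1) 0 U * B.onTorus (2 * S + 1) (Pi.single 0 (n : ℤ)) U * fermiBoltzmann U fun fl => reg.mcrit k + reg.a k * m fl / reg.Zm k) / fermiIntegral (fermiBoltzmann U fun fl => reg.mcrit k + reg.a k * m fl / reg.Zm k)) ∂(wilsonMeasure (fundamentalRep (Fin 3)) (reg.β k))) / (∫ U : GaugeConfig 4 (2 * S + 1) (Matrix.specialUnitaryGroup (Fin 3) ℂ), (‖(diracMatrix U fun fl => reg.mcrit k + reg.a k * m fl / reg.Zm k).det‖ : ℂ) ∂(wilsonMeasure (fundamentalRep (Fin 3)) (reg.β k)))‖ ≤ C' * Real.exp (-(δ' * (reg.a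 k * n))))) → (∀ m : Fin Nf → ℝ, (∀ f, 0 < m f) → ∃ Δ > 0, (reg.scheme m 0 0).HasLatticeMassGap Δ) → ∃ φ : ℕ → ℕ, ∃ hφ : StrictMono φ, ∀ m : Fin Nf → ℝ, (∀ f, 0 < m f) → ∃ (z shift : QCDField Nf → ℕ → ℝ) (T : OSData (QCDField Nf) 4), IsQCDAlong ((QCDRegularisation.restrict reg φ hφ.tendsto_atTop).scheme m z shift) T ∧ T.IsNontrivial QCDField.glue ∧ T.IsNonGaussian QCDField.glue ∧ (∀ f g : Fin Nf, f ≠ g → T.IsNontrivial (QCDField.pseudoRe f g)) ∧ ∃ Δ > 0, T.HasMassGap Δ) := Iff.rfl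

end Summit.QuantumFields.QCD.Cruxes.ChiralGluonicCompletion.GoldstoneSplit

end
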